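import Mathlib

/-!
# Finiteness of the weight-`k` orbit of an element algebraic over modular forms

Stub `stub_finiteSlashOrbit` (S9) for the crux `HilbertIntegralOverconvergentIsCongruence`
(line Sketch-ideate-r1-k1), TRANSFER step 1 (abstract algebra). A group `G` acts on a commutative
domain `L` by ring automorphisms (`MulSemiringAction`), `Γ ≤ G`, and `J : 𝓦 → G → Lˣ` are
automorphy factors additive in the weight. If `F_j` (`j ≤ D`) are modular of weight `b_j` for `Γ`,
`b_j + j • k = b_0`, some `F_j ≠ 0`, and `Σ_{j ≤ D} F_j g^j = 0`, then the weight-`k` orbit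
`{(J k γ)⁻¹ · γ • g : γ ∈ Γ}` of `g` is finite: every element is a root of the non-zero polynomial
`Σ_j F_j X^j` (apply `γ` to the relation, use `J (b_j) γ = J (b_0) γ · (J k γ)^{-j}`, cancel the
unit `J (b_0) γ`), and a non-zero polynomial over a domain has finitely many roots
(`Polynomial.finite_setOf_isRoot`).
-/

set_option linter.dupNamespace false

namespace Summit.Langlands.Langlands.Theorems.HilbertIntegralOverconvergentIsCongruence

open Polynomial

/-- **Finiteness of the weight-`k` slash orbit** (TRANSFER step 1, abstract algebra). `G` a group
acting on a commutative domain `L` by ring automorphisms (`MulSemiringAction`), `Γ ≤ G`,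
automorphy factors `J : 𝓦 → G → Lˣ` additive in the weight (`J (b + b') γ = J b γ · J b' γ`).
If `F_j` (`j ≤ D`) are modular of weight `b_j` for `Γ` (`γ • F_j = J (b_j) γ · F_j`),
`b_j + j • k = b_0`, some `F_j ≠ 0`, and `Σ_{j ≤ D} F_j g^j = 0`, then the weight-`k` orbit
`{(J k γ)⁻¹ · γ • g : γ ∈ Γ}` of `g` is finite: every element is a root of the non-zero
polynomial `Σ_j F_j X^j` (apply `γ` to the relation, use `J (b_j) γ = J (b_0) γ · (J k γ)^{-j}`,
cancel the unit `J (b_0) γ`), and `Polynomial.finite_setOf_isRoot` concludes. -/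
theorem stub_finiteSlashOrbit {G L 𝓦 : Type*} [Group G] [CommRing L] [IsDomain L] [MulSemiringAction G L]
    [AddCommGroup 𝓦] (Γ : Subgroup G) (J : 𝓦 → G → Lˣ)
    (hJ : ∀ (b b' : 𝓦) (γ : G), J (b + b') γ = J b γ * J b' γ)
    (k : 𝓦) (D : ℕ) (b : ℕ → 𝓦) (hb : ∀ j ≤ D, b j + j • k = b 0)
    (F : ℕ → L) (hF : ∀ j ≤ D, ∀ γ ∈ Γ, γ • F j = (J (b j) γ : L) * F j) (hF0 : ∃ j ≤ D, F j ≠ 0)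
    (g : L) (hrel : ∑ j ∈ Finset.range (D + 1), F j * g ^ j = 0) :
    {x : L | ∃ γ ∈ Γ, x = ((J k γ)⁻¹ : Lˣ) * γ • g}.Finite := by
  classical
  -- `J 0 γ = 1` and `J (n • k) γ = (J k γ) ^ n`, from additivity in the weight
  have hJ0 : ∀ γ : G, J 0 γ = 1 := fun γ ↦
    mul_left_cancel (a := J 0 γ) (by rw [mul_one, ← hJ, add_zero])
  have hJn : ∀ (γ : G) (n : ℕ), J (n • k) γ = J k γ ^ n := by
    intro γ n
    induction n with
    | zero => rw [zero_nsmul, pow_zero, hJ0]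
    | succ n ih => rw [succ_nsmul, hJ, ih, pow_succ]
  -- the polynomial `P = ∑_{j ≤ D} F_j X^j` is non-zero
  set P : L[X] := ∑ j ∈ Finset.range (D + 1), C (F j) * X ^ j with hP_def
  have hP : P ≠ 0 := by
    obtain ⟨j, hj, hFj⟩ := hF0
    intro h
    apply hFj
    have hc : P.coeff j = F j := by
      rw [hP_def, finsetSum_coeff]
      simp only [coeff_C_mul_X_pow]
      rw [Finset.sum_ite_eq, if_pos (Finset.mem_range.mpr (Nat.lt_succ_of_le hj))]
    rw [← hc, h, coeff_zero]
  refine (P.finite_setOf_isRoot hP).subset ?_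
  rintro x ⟨γ, hγ, rfl⟩
  -- apply the ring automorphism `γ` to the relation
  have h1 : ∑ j ∈ Finset.range (D + 1), (γ • F j) * (γ • g) ^ j = 0 := by
    have := congrArg (γ • ·) hrel
    simpa only [Finset.smul_sum, smul_mul', smul_pow', smul_zero] using this
  -- rewrite each term using modularity of `F_j` and `J (b_j) γ = J (b_0) γ * (J k γ)⁻¹ ^ j`
  have h2 : ∀ j ∈ Finset.range (D + 1),
      (γ • F j) * (γ • g) ^ j = (J (b 0) γ : L) * (F j * (((J k γ)⁻¹ : Lˣ) * γ • g) ^ j) := by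
    intro j hj
    have hj' : j ≤ D := Nat.lt_succ_iff.mp (Finset.mem_range.mp hj)
    have hJj : J (b j) γ = J (b 0) γ * (J k γ)⁻¹ ^ j := by
      rw [← hb j hj', hJ, hJn, inv_pow, mul_inv_cancel_right]
    rw [hF j hj' γ hγ, hJj, Units.val_mul, Units.val_pow_eq_pow_val]
    ring
  rw [Finset.sum_congr rfl h2, ← Finset.mul_sum] at h1
  -- cancel the unit `J (b_0) γ`
  have h3 : ∑ j ∈ Finset.range (D + 1), F j * (((J k γ)⁻¹ : Lˣ) * γ • g) ^ j = 0 :=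
    (mul_eq_zero.mp h1).resolve_left (J (b 0) γ).ne_zero
  show P.IsRoot _
  rw [IsRoot.def, hP_def, eval_finsetSum]
  simpa only [eval_mul, eval_C, eval_pow, eval_X] using h3

end Summit.Langlands.Langlands.Theorems.HilbertIntegralOverconvergentIsCongruence
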